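import Summits.PneNP.PneNP.Theorems.KrwChromaticSteeringStrongCompositionLradQuantitative
import Summits.PneNP.PneNP.Theorems.KrwChromaticSteeringStrongCompositionLrbTransfer

/-!
# Crux line `lrb-gluing` (stmt-PneNP-18538), the glued adversary on LRB II: the stub `LRBQuantitative`, PROVED

* §1 forgetting loads (`KrwLrb.RowTypeX.proj`) commutes with the LRX retyping at crossing weight `0` (`proj_retagX`: weight `0`
  keeps affine supports off combinatorial rows) and with the single-row retyping (`proj_update_combinatorial`);
* §2 `invAt_of_lrx` — **the adversary theorem for LRB**: every `LRX_0`-disciplined subtree satisfies the glued LRAD invariant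
  `KrwLrad.InvAt` (potential `ℓ + min K k ≤ depth + 2`) at the projection of its typing — leaf / label / affine / single-row test
  on a non-algebraic row by the LANDED LRAD step lemmas (`inv_leafAt`, `label_stepAt_*`, `affine_stepAt_*`, `row_stepAt_*` of
  `…LradSteps.lean`, `…LradRowSteps.lean`) verbatim, and the type-B node (single-row test on an algebraic row) by the LRAD row
  step at the typing with the row already combinatorial followed by `KrwLrb.transferB` (`…LrbTransfer.lean`);
  `lrb_rect_bound` — its root instance (`E = []`, `k = K = q`; the row game of `g` is `q`-hard by subspace-hardness on the empty
  system, per-row label-universality with budget `q ≤ n − r − 1` by the landed S3 `perRowLUOfGeneric_holds`, `AE_root` of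
  `…LradQuantitative.lean`):
  **`ℓ + q ≤ depth + 2`** for every LRB protocol; KRW form `exists_solves_of_lrbDisciplined`;
* `stub_lrbQuantitative : LRBQuantitative` — the line's REGISTERED load-bearing stub (skeleton
  `Cruxes/StrongComposition/Lines/lrb_gluing.lean`, sha 950264758b84), constant `C = 1`, statement verbatim.

Honest framing: with the bench seat's S0⁺ (`KrwLrb.stub_jointSubspaceHard`, `…LrbJointSubspaceHard.lean`) this gives the rung
C1|LRB (`…LrbRung.lean`), a CLASS-RESTRICTED form of Meir's open strong composition with `γ = 1`; the crux item stmt-PneNP-18538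
(C1, all protocols) stays open; nothing here bears on P vs NP.
-/

set_option linter.dupNamespace false -- `Summit.PneNP.PneNP.…`: summit = sub-problem name (D-0017 single-conjunct layout)
set_option autoImplicit false

namespace Summit.PneNP.PneNP.Theorems.KrwLrb

open Literature.Computability.Complexity
open Summit.PneNP.PneNP.Theorems.KrwLrad

/-! ## §1  Forgetting loads -/
section Projection

variable {m n : ℕ}

/-- `touchedRows` and `eqRows` are the same object. -/
theorem touchedRows_eq_eqRows (U : Finset (Fin m × Fin n)) : touchedRows U = eqRows U := rfl

/-- A typed row is combinatorial iff its projection is. -/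
theorem proj_eq_combinatorial_iff (t : RowTypeX) :
    t.proj = RowType.combinatorial ↔ t = RowTypeX.combinatorial := by
  cases t <;> simp [RowTypeX.proj]

/-- Weight `0`: the affine support touches no combinatorial row. -/
theorem ne_combinatorial_of_affWeight_eq_zero {U : Finset (Fin m × Fin n)} {τ : Fin m → RowTypeX}
    (h : affWeight U τ = 0) : ∀ i ∈ eqRows U, τ i ≠ RowTypeX.combinatorial := by
  intro i hi hτ
  unfold affWeight at h
  rw [Finset.card_eq_zero, Finset.filter_eq_empty_iff] at h
  exact h hi hτ

/-- Weight `0`: the projected typing has no combinatorial row under the support. -/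
theorem proj_ne_combinatorial_of_affWeight_eq_zero {U : Finset (Fin m × Fin n)} {τ : Fin m → RowTypeX}
    (h : affWeight U τ = 0) : ∀ i ∈ touchedRows U, (τ i).proj ≠ RowType.combinatorial := by
  intro i hi hc
  exact ne_combinatorial_of_affWeight_eq_zero h i hi ((proj_eq_combinatorial_iff _).1 hc)

/-- Weight `0`: retyping then forgetting loads = forgetting loads then LRAD-retyping. -/
theorem proj_retagX {U : Finset (Fin m × Fin n)} {τ : Fin m → RowTypeX} (h : affWeight U τ = 0) :
    (fun i => (retagX U τ i).proj) = retag U (fun i => (τ i).proj) := by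
  funext i
  by_cases hi : i ∈ eqRows U
  · have hτ := ne_combinatorial_of_affWeight_eq_zero h i hi
    simp [retagX, retag, touchedRows_eq_eqRows, hi, hτ, RowTypeX.proj]
  · simp [retagX, retag, touchedRows_eq_eqRows, hi]

/-- Forgetting loads commutes with sending a row to `combinatorial`. -/
theorem proj_update_combinatorial (τ : Fin m → RowTypeX) (i : Fin m) :
    (fun i' => (Function.update τ i RowTypeX.combinatorial i').proj)
      = Function.update (fun i' => (τ i').proj) i RowType.combinatorial := by
  funext i'
  by_cases h : i' = i
  · subst h; simp [RowTypeX.proj]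
  · simp [Function.update_of_ne h]

end Projection

/-! ## §2  The adversary theorem, the root bound, the stub -/

section Main

variable {m n : ℕ} {g : (Fin n → Bool) → Bool} {q r : ℕ}

/-- Per-row label-universality is antitone in the budget. -/
theorem perRowLU_mono {q q' : ℕ} (h : q ≤ q') (hLU : PerRowLU g m q') : PerRowLU g m q :=
  fun E hload hsat v => hLU E (fun i => (hload i).trans h) hsat v

/-- **The adversary theorem for LRB**: every `LRX_0`-disciplined subtree satisfies the glued LRAD invariant `InvAt` at the
projection of its typing.  Leaf / label test / affine test (weight `0` keeps the support off combinatorial rows) / single-row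
test on a non-algebraic row: the landed LRAD step lemmas verbatim; single-row test on an ALGEBRAIC row (type B): the LRAD
row step at the typing with row `i` already combinatorial, then `transferB`. -/
theorem invAt_of_lrx (hgen : AffGeneric g r) (hqr : q + r + 1 ≤ n) (hsub : SubspaceHard g q)
    (hLU : PerRowLU g m q) (i₀ : Fin m) (j₀ : Fin n) :
    ∀ (N : KWTree (Fin m × Fin n)) (τ : Fin m → RowTypeX), LRXDisciplinedOn g 0 τ N →
      InvAt g q (fun i => (τ i).proj) N
  | .leaf p, τ, _ => inv_leafAt hLU p _
  | .alice s P Q, τ, h => by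
    obtain ⟨τ', w, hN, hw, hP, hQ⟩ := h
    obtain rfl : w = 0 := Nat.le_zero.1 hw
    have ihP := invAt_of_lrx hgen hqr hsub hLU i₀ j₀ P τ' hP
    have ihQ := invAt_of_lrx hgen hqr hsub hLU i₀ j₀ Q τ' hQ
    rcases hN with ⟨⟨φ, hφ⟩, hτ', -⟩ | ⟨U, c, hs, hτ', hW⟩ | ⟨i, ψ, hs, hτ', -⟩
    · subst hτ'; exact label_stepAt_alice i₀ hφ ihP ihQ
    · subst hτ'
      have hW0 : affWeight U τ = 0 := hW.symm
      rw [proj_retagX hW0] at ihP ihQ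
      exact affine_stepAt_alice hLU hs (proj_ne_combinatorial_of_affWeight_eq_zero hW0) ihP ihQ
    · subst hτ'
      rw [proj_update_combinatorial] at ihP ihQ
      by_cases hτi : (τ i).proj = RowType.algebraic
      · refine transferB hgen hqr hsub (τ := fun i' => (τ i').proj) hτi ?_
        refine row_stepAt_alice i₀ j₀ hs (by simp) ?_ ?_
        · rwa [Function.update_idem]
        · rwa [Function.update_idem]
      · exact row_stepAt_alice i₀ j₀ hs hτi ihP ihQ
  | .bob s P Q, τ, h => by
    obtain ⟨τ', w, hN, hw, hP, hQ⟩ := h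
    obtain rfl : w = 0 := Nat.le_zero.1 hw
    have ihP := invAt_of_lrx hgen hqr hsub hLU i₀ j₀ P τ' hP
    have ihQ := invAt_of_lrx hgen hqr hsub hLU i₀ j₀ Q τ' hQ
    rcases hN with ⟨⟨φ, hφ⟩, hτ', -⟩ | ⟨U, c, hs, hτ', hW⟩ | ⟨i, ψ, hs, hτ', -⟩
    · subst hτ'; exact label_stepAt_bob i₀ hφ ihP ihQ
    · subst hτ'
      have hW0 : affWeight U τ = 0 := hW.symm
      rw [proj_retagX hW0] at ihP ihQ
      exact affine_stepAt_bob hLU hs (proj_ne_combinatorial_of_affWeight_eq_zero hW0) ihP ihQ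
    · subst hτ'
      rw [proj_update_combinatorial] at ihP ihQ
      by_cases hτi : (τ i).proj = RowType.algebraic
      · refine transferB hgen hqr hsub (τ := fun i' => (τ i').proj) hτi ?_
        refine row_stepAt_bob i₀ j₀ hs (by simp) ?_ ?_
        · rwa [Function.update_idem]
        · rwa [Function.update_idem]
      · exact row_stepAt_bob i₀ j₀ hs hτi ihP ihQ

/-- **The glued adversary bound on LRB, sharp form**: `ℓ + q ≤ depth + 2` for every LRB protocol for `KW_f ⊛ KW_g`, `f`
non-constant with `ℓ`-hard KW rectangle, `g` `r`-affine-generic and subspace-hard with budget `q ≥ 1`, `q + r + 1 ≤ n`. -/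
theorem lrb_rect_bound {f : (Fin m → Bool) → Bool} {ℓ : ℕ} (hf : ∃ a b, f a = true ∧ f b = false)
    (hgen : AffGeneric g r) (hqr : q + r + 1 ≤ n) (hsub : SubspaceHard g q) (hq : 1 ≤ q)
    (hH : Hard (f ⁻¹' {true}) (f ⁻¹' {false}) ℓ) {P : KWTree (Fin m × Fin n)} (hP : LRBDisciplined g P)
    (hsol : P.SolvesStrong f g) : ℓ + q ≤ P.depth + 2 := by
  classical
  -- `m ≥ 1` (f non-constant) and a coordinate `i₀`; `n ≥ 1` and a coordinate `j₀`
  obtain ⟨a₁, b₁, hfa₁, hfb₁⟩ := hf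
  have hm : 0 < m := by
    rcases Nat.eq_zero_or_pos m with h0 | h0
    · exfalso
      subst h0
      have : a₁ = b₁ := funext fun i => i.elim0
      rw [this, hfb₁] at hfa₁
      exact Bool.false_ne_true hfa₁
    · exact h0
  let i₀ : Fin m := ⟨0, hm⟩
  let j₀ : Fin n := ⟨0, by omega⟩
  -- the row game of `g` itself is `q`-hard (subspace-hardness on the empty system); `g` takes both values
  have hKW : Hard {x | (∀ e ∈ ([] : List (Finset (Fin n) × Bool)), rowParity e.1 x = e.2) ∧ g x = true}
      {x | (∀ e ∈ ([] : List (Finset (Fin n) × Bool)), rowParity e.1 x = e.2) ∧ g x = false} q := by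
    simpa using hsub [] (by simp) ⟨fun _ => false, by simp⟩
  have hsetα : ∀ α : Bool, {x | (∀ e ∈ ([] : List (Finset (Fin n) × Bool)), rowParity e.1 x = e.2) ∧ g x = α}
      = RA g (fun _ : Fin m => (Set.univ : Set (Fin n → Bool))) i₀ α := by
    intro α; ext x; simp [RA]
  obtain ⟨u, hu⟩ := hKW.nonempty_left hq j₀
  obtain ⟨v, hv⟩ := hKW.nonempty_right hq j₀
  have hgu : g u = true := by simpa using hu
  have hgv : g v = false := by simpa using hv
  have hgα : ∀ α : Bool, ∃ x, g x = α := fun α => by cases α; exacts [⟨v, hgv⟩, ⟨u, hgu⟩]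
  -- per-row label-universality with budget `q ≤ n - r - 1`
  have hLU : PerRowLU g m q :=
    perRowLU_mono (by omega) (perRowLUOfGeneric_holds m n r g ⟨u, v, hgu, hgv⟩ hgen)
  -- the root state
  let U : Fin m → Set (Fin n → Bool) := fun _ => Set.univ
  set A : Set (Fin m → Bool) := f ⁻¹' {true} with hA
  set B : Set (Fin m → Bool) := f ⁻¹' {false} with hB
  have hAE_A : AE g A U = A := AE_root hgα A
  have hAE_B : AE g B U = B := AE_root hgα B
  have hst : StateOK (fun _ : Fin m => (RowTypeX.fresh).proj) U U ([] : AffSys m n) := fun i =>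
    ⟨fun _ => rowLoad_nil i, fun _ => ⟨rfl, rfl⟩⟩
  have hsat0 : ∃ X, Sat ([] : AffSys m n) X := ⟨fun _ => false, fun e he => by simp at he⟩
  have hload : ∀ i, rowLoad ([] : AffSys m n) i + q ≤ q := fun i => by rw [rowLoad_nil, Nat.zero_add]
  have hV : ValidOnE g P A B U U [] := by
    intro X hX Y hY
    have hX1 : f (rowLabels g X) = true := by simpa [hA] using hX.1
    have hY1 : f (rowLabels g Y) = false := by simpa [hB] using hY.1
    exact hsol X Y (by rw [blockComp_apply]; exact hX1) (by rw [blockComp_apply]; exact hY1)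
  have hD : ∀ a ∈ AE g A U, ∀ b ∈ AE g B U, a ≠ b := by
    rw [hAE_A, hAE_B]
    rintro a ha b hb rfl
    have ha' : f a = true := by simpa [hA] using ha
    have hb' : f a = false := by simpa [hB] using hb
    rw [ha'] at hb'
    exact Bool.noConfusion hb'
  have hneA : (AE g A U).Nonempty := by rw [hAE_A]; exact ⟨a₁, by simpa [hA] using hfa₁⟩
  have hneB : (AE g B U).Nonempty := by rw [hAE_B]; exact ⟨b₁, by simpa [hB] using hfb₁⟩
  have hL : Hard (AE g A U) (AE g B U) ℓ := by rw [hAE_A, hAE_B]; exact hH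
  have hR : ∀ i α, Alive g A B U U i α → Hard (RA g U i α) (RA g U i (!α)) q := by
    intro i α _
    have hi : ∀ β, RA g U i β = RA g U i₀ β := fun β => rfl
    rw [hi, hi, ← hsetα, ← hsetα]
    cases α
    · exact hard_swap hKW
    · exact hKW
  have hK : ∀ i α, Alive g A B U U i α → q ≤ q + cst (AE g A U) i + cst (AE g B U) i :=
    fun _ _ _ => by omega
  have hmain := invAt_of_lrx hgen hqr hsub hLU i₀ j₀ P (fun _ => RowTypeX.fresh) hP A B U U [] q hst hsat0
    hload hV hD hneA hneB ℓ q (fun _ _ => q) hL hR hK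
  rwa [Nat.min_self] at hmain

/-- **The registered stub `stub_lrbQuantitative` of line `lrb-gluing`, PROVED** (constant `C = 1`): for a non-constant outer `f`
with `ℓ`-hard Karchmer–Wigderson rectangle and an inner `g` that is `r`-affine-generic and subspace-hard with budget `q ≥ 1`,
`q + r + 1 ≤ n`, every LRB protocol for the strong composition game `KW_f ⊛ KW_g` has depth `≥ ℓ + q − 2` (from the sharp form
`lrb_rect_bound`).  Statement VERBATIM the skeleton's `LRBQuantitative`. -/
theorem stub_lrbQuantitative : LRBQuantitative := by
  refine ⟨1, ?_⟩
  intro m n q r ℓ f g hf hgen hqr hsub hq hH P hP hsol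
  have h := lrb_rect_bound hf hgen hqr hsub hq hH hP hsol
  omega

/-- KRW form of the bound: from any LRB protocol `P` for `KW_f ⊛ KW_g` (`f` non-constant, `g` `r`-generic and subspace-hard with
budget `q ≥ 1`, `q + r + 1 ≤ n`) a `KW_f` protocol `Q` with `Q.depth + q ≤ P.depth + 2`. -/
theorem exists_solves_of_lrbDisciplined {f : (Fin m → Bool) → Bool} (hf : ∃ a b, f a ≠ f b)
    (hgen : AffGeneric g r) (hqr : q + r + 1 ≤ n) (hsub : SubspaceHard g q) (hq : 1 ≤ q)
    {P : KWTree (Fin m × Fin n)} (hP : LRBDisciplined g P) (hsol : P.SolvesStrong f g) :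
    ∃ Q : KWTree (Fin m), Q.Solves f ∧ Q.depth + q ≤ P.depth + 2 := by
  classical
  have hne : ∃ a b, f a = true ∧ f b = false := by
    obtain ⟨a, b, hab⟩ := hf
    cases ha : f a <;> cases hb : f b
    · rw [ha, hb] at hab; exact absurd rfl hab
    · exact ⟨b, a, hb, ha⟩
    · exact ⟨a, b, ha, hb⟩
    · rw [ha, hb] at hab; exact absurd rfl hab
  by_contra hcon
  push Not at hcon
  set ℓ := P.depth + 3 - q with hℓ
  have hH : Hard (f ⁻¹' {true}) (f ⁻¹' {false}) ℓ := by
    intro Q hQ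
    have hs : Q.Solves f := fun a b ha hb => hQ a (by simpa using ha) b (by simpa using hb)
    have := hcon Q hs
    omega
  have hmain := lrb_rect_bound hne hgen hqr hsub hq hH hP hsol
  omega

end Main

end Summit.PneNP.PneNP.Theorems.KrwLrb
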